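import Mathlib
import Summits.ValiantsHypothesis.ValiantsHypothesis.Theses.FreeSubtorus
import Summits.ValiantsHypothesis.ValiantsHypothesis.Cruxes.OrbitDimensionBound.Lines.ConfusionLadder
import Literature.Computability.AlgebraicComplexity.LandsbergRessayreProofs
import Summits.ValiantsHypothesis.ValiantsHypothesis.Theorems.FreeSubtorusConfusionCoveringGenericElement
import Summits.ValiantsHypothesis.ValiantsHypothesis.Theorems.FreeSubtorusConfusionCoveringPathWeights
import Summits.ValiantsHypothesis.ValiantsHypothesis.Theorems.FreeSubtorusConfusionCoveringClassCount

/-!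
# `ConfusionCovering` — line skeleton (BC3) for the forward rung over the PROVED floor `SubtorusCovering`
# (crux dir of stmt-ValiantsHypothesis-16133 `OrbitDimensionBound`, route FreeSubtorus; G1 next-rung)

RUNG, BY NAME: `Summit.ValiantsHypothesis.ValiantsHypothesis.Cruxes.OrbitDimensionBound.Confusion.ConfusionCovering`
(`Lines/ConfusionLadder.lean`) — for `n ≥ 3`, every `T_Λ`-equivariant (exact `GL_m × GL_m` lifts) affine determinantal
representation `B` of `per_n` of size `m`, `Λ : Fin r → (Fin n ⊕ Fin n) → ℤ` admissible, satisfies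
`C(n, ⌊n/2⌋) ≤ m · κ_{⌊n/2⌋}(Λ)`, `κ_d(Λ) = confusion n r Λ d` the CONFUSION NUMBER (largest class of level-`d` pairs
`(S, T)` whose indicator characters are congruent modulo `span_ℚ Λ`).  FLOOR (proved, seed g1-ValiantsHypothesis-16134):
the same with `2^r` (`Theorems.FreeSubtorusSubtorusCovering.subtorusCovering_proof`); `κ ≤ 2^r` (Odlyzko).
WITNESS: `Lines/confusion_covering_special.lean`; ON-PATH: `Lines/confusion_covering_onpath.lean`.

## The line: ONE generic element of the subtorus, counted by CONFUSION CLASSES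

This is the registered birth line of the floor (`Cruxes/SubtorusCovering/Lines/birth.lean`, namespace `…Birth`) with its
third stub — the Odlyzko level count `C(n,⌊n/2⌋) ≤ m · 2^r` — replaced by the CLASS COUNT `C(n,⌊n/2⌋) ≤ m · κ_{⌊n/2⌋}(Λ)`,
which needs no hypercube lemma at all: the position information that the floor's LANDED proof (pair sacrifice,
`Theorems/FreeSubtorusSubtorusCovering.lean`: maximal independent partial matching, branch `n ≤ s + 2`, substitution to
`per_{n-s}` and the `r = 0` TorusBound — bound `2^{n-s} - 1 ≤ m`) throws away is exactly what the generic element keeps.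

(1) GENERIC ELEMENT (`stub_genericElement`, verbatim from the floor's birth line, size M).  Zero ROW-sums of the
generators give `d e : Fin n → ℂˣ` with (i) the `r` relations (so `diag(d_k e_l)` is a generator of `T_Λ`), (ii) no
closed weight walk, (iii) exact separation: a character is `1` at `(d, e)` only if it lies in `Λ_sat`.
(2) GRADED PATH EXPANSION (`stub_pathWeights`, verbatim, size L, the heart).  Regularity (von zur Gathen, tree) + the
exact lift `(g, h)` of the generic element + generalised-eigenspace gradings + Leibniz/Hamiltonian-path expansion: every
`σ ∈ S_n` is served at every level `1 ≤ i ≤ n` by a weight `γ₀ ∏_{k∈I} d_k e_{σ k}` of `g`, `|I| = i`.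
(3) CLASS COUNT (`stub_classCount`, NEW, size M).  At level `⌊n/2⌋`: distinct served weights are distinct eigenvalues of
`g` with independent generalised eigenspaces, so `≤ m` of them; two served pairs `(I, σI)`, `(I', σ'I')` with the same
weight have `d^{1_I - 1_{I'}} e^{1_{σI} - 1_{σ'I'}} = 1`, so by (iii) `N · ((1_I;1_{σI}) - (1_{I'};1_{σ'I'})) ∈ ℤΛ`,
`N ≠ 0`, i.e. the pairs are `Confused` (divide by `N` in `ℚ`): a weight class of pairs is contained in one confusion
class, of size `≤ κ_{⌊n/2⌋}(Λ)` BY DEFINITION (`classCount_le_confusion`); a pair `(I, J)` serves the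
`⌊n/2⌋! (n-⌊n/2⌋)!` permutations with `σ(I) = J`; every `σ` is served.  Hence `n! ≤ m · κ · ⌊n/2⌋!(n-⌊n/2⌋)!`, i.e.
`C(n, ⌊n/2⌋) ≤ m · κ_{⌊n/2⌋}(Λ)`.

COMPOSITION `ConfusionCovering_of : Stmt.stub_genericElement → Stmt.stub_pathWeights → Stmt.stub_classCount →
ConfusionCovering` — kernel-checked, NO sorry; it is the floor's birth composition `SubtorusCovering_of` verbatim up to
the last line (stub 3's conclusion).  `ConfusionCovering_proof : ConfusionCovering` from the three registered stubs.

## Stubs (registered; the ONLY `sorry`s of this file)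
* `stub_genericElement` (M) — ℚ-linear algebra `(Λ^⊥)^⊥ = span_ℚ Λ`, rationally independent reals, injectivity of
  real `exp`; only the ROW half of admissibility.  SHARED VERBATIM with `Cruxes/SubtorusCovering/Lines/birth.lean`
  (one proof closes both).
* `stub_pathWeights` (L, hardest) — SHARED VERBATIM with the floor's birth line and with `TorusBound`'s registered
  `stub_pathWeights` (primes ↦ acyclic weights).  Leans on: `GenericTorusGrading` /`LRTorusWeights` eigenspace toolkit
  (`map_maxGenEigenspace_le_of_comp_eq_smul`), `Matrix.det_apply`, `coeff` of `perPoly`, `LRPencilOfMatrix.map_eval_eq`,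
  the landed `Theorems.FreeSubtorusOrbitDimensionBoundStubEigenGauge` / `…StubHomothetyGraded` (graded normal forms).
* `stub_classCount` (M, new) — `Module.End.independent_maxGenEigenspace`, `iSupIndep.subtype_ne_bot_le_finrank`,
  `Nat.choose_mul_factorial_mul_factorial`, `Fintype.card_perm`, counting `{σ : σ(I) = J}`, and
  `Confusion.classCount_le_confusion` (this crux dir) — NO Odlyzko lemma.
Each stub can land as `Theorems/FreeSubtorusConfusionCovering<Stub>.lean --supports stmt-ValiantsHypothesis-16133`.

## Why this is not the floor again (F7) and not the summit (t1h)
`floor → rung` does not close: for `Λ` in general position of rank `≥ n - 2` the floor is the empty inequality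
`C(n,⌊n/2⌋) ≤ m · 2^r` (`m ≥ n`, `2^r ≥ 2^{n-2}`) while the rung asserts `C(n,⌊n/2⌋) ≤ m`.  `rung → VP ≠ VNP` does not
close: the rung bounds only EQUIVARIANT representations; the summit needs the symmetrisation step (host crux
`OrbitDimensionBound`, relaxed by this rung to `Confusion.OrbitConfusionBound`, `Confusion.closes_relaxed`).

**Disproof used.** `Cruxes/OrbitDimensionBound/Disproof.lean` concerns the symmetrisation crux (in-place homothety
refutations `InPlaceHomothety`, `InPlaceModAdmissible`, Koszul-twisted Grenet at `n = 3`); this line proves a LOWER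
bound for already-equivariant representations and instantiates none of its `-- Targets`; no `_false_without_` theorem
there quantifies over covering statements.  `ledger negatives --problem ValiantsHypothesis`: nothing on (sub)torus-
equivariant lower bounds (entries: UlrichPadded NoTightInfinity, Elusive candidate, GrenetRigidity optimal-uniqueness ×2,
…) — uniqueness of optimal representations is NOT used.  Census D3 of `STRATEGY-CENSUS.md` (mixed hypercube-aligned `Λ`
of rank `n/2` leave room at `n = 4`) is CONSISTENT with the rung: such `Λ` have `κ_2 = 4 = 2^r`, where rung = floor.
-/

namespace Summit.ValiantsHypothesis.ValiantsHypothesis.Cruxes.OrbitDimensionBound.Confusion.Line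

open Matrix MvPolynomial Finset
open Literature.Computability.AlgebraicComplexity LRPencil
open Summit.ValiantsHypothesis.ValiantsHypothesis.Cruxes.OrbitDimensionBound.Confusion
open scoped Kronecker

set_option linter.dupNamespace false

noncomputable section

/-! ## §1 The three stub statements as `Prop`s (named like the registered stubs) -/

/-- Statement of stub 1 (`stub_genericElement`) — a generic element of an admissibly cut subtorus (relations,
no closed weight walk, exact separation modulo `Λ_sat`).  VERBATIM the floor's birth stub 1.
[cite: LandsbergRessayre2017, §6] -/
def Stmt.stub_genericElement : Prop :=
  ∀ (n r : ℕ) (Λ : Fin r → (Fin n ⊕ Fin n) → ℤ),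
    (∀ i, (∑ k, Λ i (Sum.inl k)) = 0) →
    ∃ d e : Fin n → ℂˣ,
      (∀ i, (∏ k, (d k) ^ (Λ i (Sum.inl k))) * (∏ l, (e l) ^ (Λ i (Sum.inr l))) = 1) ∧
      (∀ u : Fin n × Fin n → ℕ, u ≠ 0 → (∏ p, ((d p.1 : ℂ) * (e p.2 : ℂ)) ^ (u p)) ≠ 1) ∧
      (∀ χ : (Fin n ⊕ Fin n) → ℤ,
        (∏ k, (d k) ^ (χ (Sum.inl k))) * (∏ l, (e l) ^ (χ (Sum.inr l))) = 1 →
        ∃ (N : ℤ) (a : Fin r → ℤ), N ≠ 0 ∧ N • χ = ∑ i, a i • Λ i)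

/-- Statement of stub 2 (`stub_pathWeights`) — every permutation is served at every level by a weight of `g`, for
an arbitrary weight without closed walks, a REGULAR representation and an exact lift `(g, h)`.  VERBATIM the floor's
birth stub 2 (= `TorusBound`'s registered `stub_pathWeights` with primes replaced by acyclic weights).
[cite: LandsbergRessayre2017, §6] [cite: Grenet2011] -/
def Stmt.stub_pathWeights : Prop :=
  ∀ (n m : ℕ) (A : Matrix (Fin m) (Fin m) (MvPolynomial (Fin n × Fin n) ℂ)) (c : Fin n × Fin n → ℂ)
    (g h : GL (Fin m) ℂ) (γ₀ : ℂ),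
    (∀ p, c p ≠ 0) →
    (∀ u : Fin n × Fin n → ℕ, u ≠ 0 → (∏ p, (c p) ^ (u p)) ≠ 1) →
    IsRegularDetRepr (perPoly (Fin n) ℂ) A →
    (g : Matrix (Fin m) (Fin m) ℂ) * constPart A = constPart A * (h : Matrix (Fin m) (Fin m) ℂ) →
    (∀ p : Fin n × Fin n, (g : Matrix (Fin m) (Fin m) ℂ) * coeffMat A p =
        c p • (coeffMat A p * (h : Matrix (Fin m) (Fin m) ℂ))) →
    LinearMap.ker (Matrix.toLin' (constPart A)) ≤
      Module.End.maxGenEigenspace (Matrix.toLin' (h : Matrix (Fin m) (Fin m) ℂ)) γ₀ →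
    ∀ (σ : Equiv.Perm (Fin n)) (i : ℕ), 1 ≤ i → i ≤ n →
      ∃ I : Finset (Fin n), I.card = i ∧
        Module.End.maxGenEigenspace (Matrix.toLin' (g : Matrix (Fin m) (Fin m) ℂ))
          (γ₀ * ∏ k ∈ I, c (k, σ k)) ≠ ⊥

/-- Statement of stub 3 (`stub_classCount`) — **the class count at the middle level** (NEW; replaces the floor's
Odlyzko level count).  If `γ₀ ≠ 0`, `(d, e)` separates characters exactly modulo `Λ_sat` and an endomorphism
`toLin' g` of `ℂ^m` has, for every `σ ∈ S_n`, a non-zero generalised eigenspace at `γ₀ ∏_{k∈I} d_k e_{σ k}` for some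
`⌊n/2⌋`-set `I`, then `C(n, ⌊n/2⌋) ≤ m · κ_{⌊n/2⌋}(Λ)`: served weights are `≤ m` (independent eigenspaces), a weight
class of served pairs `(I, σ I)` lies in ONE confusion class (exact separation ⇒ `Confused`), of size `≤ κ` by
definition (`classCount_le_confusion`), and a pair serves `⌊n/2⌋! (n - ⌊n/2⌋)!` permutations.
[cite: LandsbergRessayre2017, §6] -/
def Stmt.stub_classCount : Prop :=
  ∀ (n m r : ℕ) (Λ : Fin r → (Fin n ⊕ Fin n) → ℤ) (d e : Fin n → ℂˣ) (γ₀ : ℂ)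
    (g : Matrix (Fin m) (Fin m) ℂ),
    γ₀ ≠ 0 →
    (∀ χ : (Fin n ⊕ Fin n) → ℤ,
      (∏ k, (d k) ^ (χ (Sum.inl k))) * (∏ l, (e l) ^ (χ (Sum.inr l))) = 1 →
      ∃ (N : ℤ) (a : Fin r → ℤ), N ≠ 0 ∧ N • χ = ∑ i, a i • Λ i) →
    (∀ σ : Equiv.Perm (Fin n), ∃ I : Finset (Fin n), I.card = n / 2 ∧
      Module.End.maxGenEigenspace (Matrix.toLin' g)
        (γ₀ * ∏ k ∈ I, ((d k : ℂ) * (e (σ k) : ℂ))) ≠ ⊥) →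
    n.choose (n / 2) ≤ m * confusion n r Λ (n / 2)

/-! ## §2 Registered stubs (the ONLY sorries of this file) -/

/-- **Registered stub 1 = `Stmt.stub_genericElement`** (size M; shared verbatim with the floor's birth line).
[cite: LandsbergRessayre2017, §6] -/
theorem stub_genericElement :
    ∀ (n r : ℕ) (Λ : Fin r → (Fin n ⊕ Fin n) → ℤ),
    (∀ i, (∑ k, Λ i (Sum.inl k)) = 0) →
    ∃ d e : Fin n → ℂˣ,
      (∀ i, (∏ k, (d k) ^ (Λ i (Sum.inl k))) * (∏ l, (e l) ^ (Λ i (Sum.inr l))) = 1) ∧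
      (∀ u : Fin n × Fin n → ℕ, u ≠ 0 → (∏ p, ((d p.1 : ℂ) * (e p.2 : ℂ)) ^ (u p)) ≠ 1) ∧
      (∀ χ : (Fin n ⊕ Fin n) → ℤ,
        (∏ k, (d k) ^ (χ (Sum.inl k))) * (∏ l, (e l) ^ (χ (Sum.inr l))) = 1 →
        ∃ (N : ℤ) (a : Fin r → ℤ), N ≠ 0 ∧ N • χ = ∑ i, a i • Λ i) :=
  -- LANDED (p177811); closed by name — wired 2026-08-28 by val-width-16133-w1 g2
  Summit.ValiantsHypothesis.ValiantsHypothesis.Theorems.FreeSubtorusConfusionCovering.stub_genericElement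

/-- **Registered stub 2 = `Stmt.stub_pathWeights`** (size L, the hardest; shared verbatim with the floor's birth line
and with `TorusBound`'s registered stub). [cite: LandsbergRessayre2017, §6] -/
theorem stub_pathWeights :
    ∀ (n m : ℕ) (A : Matrix (Fin m) (Fin m) (MvPolynomial (Fin n × Fin n) ℂ)) (c : Fin n × Fin n → ℂ)
    (g h : GL (Fin m) ℂ) (γ₀ : ℂ),
    (∀ p, c p ≠ 0) →
    (∀ u : Fin n × Fin n → ℕ, u ≠ 0 → (∏ p, (c p) ^ (u p)) ≠ 1) →
    IsRegularDetRepr (perPoly (Fin n) ℂ) A →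
    (g : Matrix (Fin m) (Fin m) ℂ) * constPart A = constPart A * (h : Matrix (Fin m) (Fin m) ℂ) →
    (∀ p : Fin n × Fin n, (g : Matrix (Fin m) (Fin m) ℂ) * coeffMat A p =
        c p • (coeffMat A p * (h : Matrix (Fin m) (Fin m) ℂ))) →
    LinearMap.ker (Matrix.toLin' (constPart A)) ≤
      Module.End.maxGenEigenspace (Matrix.toLin' (h : Matrix (Fin m) (Fin m) ℂ)) γ₀ →
    ∀ (σ : Equiv.Perm (Fin n)) (i : ℕ), 1 ≤ i → i ≤ n →
      ∃ I : Finset (Fin n), I.card = i ∧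
        Module.End.maxGenEigenspace (Matrix.toLin' (g : Matrix (Fin m) (Fin m) ℂ))
          (γ₀ * ∏ k ∈ I, c (k, σ k)) ≠ ⊥ :=
  -- LANDED (Theorems/FreeSubtorusConfusionCoveringPathWeights.lean); closed by name — wired 2026-08-28 by val-width-16133-w1 g2
  Summit.ValiantsHypothesis.ValiantsHypothesis.Theorems.FreeSubtorusConfusionCovering.stub_pathWeights

/-- **Registered stub 3 = `Stmt.stub_classCount`** (size M, NEW: the count by confusion classes; no Odlyzko).
[cite: LandsbergRessayre2017, §6] -/
theorem stub_classCount :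
    ∀ (n m r : ℕ) (Λ : Fin r → (Fin n ⊕ Fin n) → ℤ) (d e : Fin n → ℂˣ) (γ₀ : ℂ)
    (g : Matrix (Fin m) (Fin m) ℂ),
    γ₀ ≠ 0 →
    (∀ χ : (Fin n ⊕ Fin n) → ℤ,
      (∏ k, (d k) ^ (χ (Sum.inl k))) * (∏ l, (e l) ^ (χ (Sum.inr l))) = 1 →
      ∃ (N : ℤ) (a : Fin r → ℤ), N ≠ 0 ∧ N • χ = ∑ i, a i • Λ i) →
    (∀ σ : Equiv.Perm (Fin n), ∃ I : Finset (Fin n), I.card = n / 2 ∧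
      Module.End.maxGenEigenspace (Matrix.toLin' g)
        (γ₀ * ∏ k ∈ I, ((d k : ℂ) * (e (σ k) : ℂ))) ≠ ⊥) →
    n.choose (n / 2) ≤ m * confusion n r Λ (n / 2) := by
  -- LANDED (Theorems/FreeSubtorusConfusionCoveringClassCount.lean, class form `∃ q, … ≤ m · #class(q)`); closed by name
  -- up to `classCount_le_confusion` — wired 2026-08-28 by val-width-16133-w1 g2
  intro n m r Λ d e γ₀ g hγ hsep hserved
  obtain ⟨q, hq1, hq2, hle⟩ :=
    Summit.ValiantsHypothesis.ValiantsHypothesis.Theorems.FreeSubtorusConfusionCovering.stub_classCount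
      n m r Λ d e γ₀ g hγ hsep hserved
  exact hle.trans (Nat.mul_le_mul_left m (classCount_le_confusion Λ q hq1 hq2))

/-! ## §3 The composition (kernel-checked, sorry-free) -/

/-- Summing a family against a row of a diagonal matrix picks out the diagonal entry. [folklore] -/
theorem sum_diagonal_smul {ι M : Type*} [Fintype ι] [DecidableEq ι] [AddCommMonoid M] [Module ℂ M]
    (c : ι → ℂ) (B : ι → M) (v : ι) :
    ∑ i, (Matrix.diagonal c) v i • B i = c v • B v := by
  rw [Finset.sum_eq_single v]
  · rw [Matrix.diagonal_apply_eq]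
  · intro i _ hi
    rw [Matrix.diagonal_apply_ne _ (Ne.symm hi), zero_smul]
  · intro hv
    exact absurd (Finset.mem_univ v) hv

/-- **The rung from the three stubs** (real proof; the floor's birth composition with the last line changed).
(0) regularity (von zur Gathen 1987 Thm 3.1, tree); (1) stub 1: generic `(d, e)` (row half of admissibility);
(2) `diag(d_k e_l)` is a generator of `T_Λ`; (3) its exact lift `(g, h)` read on coefficient matrices;
(4) `rank Λ₀ = m - 1` ⇒ kernel line, eigenvalue `γ₀ ≠ 0` of `h`; (5) stub 2 at level `⌊n/2⌋`; (6) stub 3.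
[cite: LandsbergRessayre2017, Thm. 2.8, §6] [cite: Vonzurgathen1987, Thm. 3.1] -/
theorem ConfusionCovering_of :
    Stmt.stub_genericElement → Stmt.stub_pathWeights → Stmt.stub_classCount →
      Summit.ValiantsHypothesis.ValiantsHypothesis.Cruxes.OrbitDimensionBound.Confusion.ConfusionCovering := by
  intro hGE hPW hLC
  unfold Stmt.stub_genericElement at hGE
  unfold Stmt.stub_pathWeights at hPW
  unfold Stmt.stub_classCount at hLC
  intro n hn m r Λ B hΛ hB
  classical
  -- (0) the affine data and regularity (von zur Gathen 1987, Thm. 3.1, proved in the tree)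
  have haff : ∀ i j, (B i j).totalDegree ≤ 1 := hB.1.1
  have hdet : B.det = perPoly (Fin n) ℂ := hB.1.2
  have hreg : IsRegularDetRepr (perPoly (Fin n) ℂ) B :=
    hB.isRegular_perPoly vonzurGathen1987_perm_detRepr_rank_holds hn
  -- (1) a generic element `(d, e)` of the subtorus (stub 1; only the ROW half of admissibility is used)
  obtain ⟨d, e, hrel, hnocyc, hsep⟩ := hGE n r Λ (fun i => (hΛ i).1)
  have hc0 : ∀ p : Fin n × Fin n, ((fun p : Fin n × Fin n => (d p.1 : ℂ) * (e p.2 : ℂ)) p) ≠ 0 :=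
    fun p => mul_ne_zero (d p.1).ne_zero (e p.2).ne_zero
  have hd0 : ∀ k, ((fun k => (d k : ℂ)) k) ≠ 0 := fun k => (d k).ne_zero
  have he0 : ∀ l, ((fun l => (e l : ℂ)) l) ≠ 0 := fun l => (e l).ne_zero
  -- (2) the torus element `x_{kl} ↦ d_k e_l x_{kl}` = `diag(d) ⊗ diag(e) ∈ GL(n²)`; it is a generator of `T_Λ`
  let γ : GL (Fin n × Fin n) ℂ :=
    Matrix.GeneralLinearGroup.kronecker (diagUnit ℂ (fun k => (d k : ℂ)) hd0) (diagUnit ℂ (fun l => (e l : ℂ)) he0)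
  have hγcoe : (γ : Matrix (Fin n × Fin n) (Fin n × Fin n) ℂ) =
      Matrix.diagonal (fun p : Fin n × Fin n => (d p.1 : ℂ) * (e p.2 : ℂ)) := by
    show Matrix.diagonal _ ⊗ₖ Matrix.diagonal _ = _
    exact Matrix.diagonal_kronecker_diagonal _ _
  have hγmem : γ ∈ Subgroup.closure {γ : Matrix.GeneralLinearGroup (Fin n × Fin n) ℂ |
      ∃ d e : Fin n → ℂˣ, (∀ i, (∏ k, (d k) ^ (Λ i (Sum.inl k))) * (∏ l, (e l) ^ (Λ i (Sum.inr l))) = 1) ∧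
        (γ : Matrix (Fin n × Fin n) (Fin n × Fin n) ℂ) =
          Matrix.diagonal (fun p => (d p.1 : ℂ) * (e p.2 : ℂ))} :=
    Subgroup.subset_closure ⟨d, e, hrel, hγcoe⟩
  -- (3) its exact lift `(g, h)`: `g Λ₀ = Λ₀ h` and `g B_p = d_{p.1} e_{p.2} B_p h`
  obtain ⟨g, h, hgh, hΛ0⟩ := hB.exists_lift_stabilising hγmem
  have hAv : ∀ p : Fin n × Fin n, (g : Matrix (Fin m) (Fin m) ℂ) * coeffMat B p =
      ((d p.1 : ℂ) * (e p.2 : ℂ)) • (coeffMat B p * (h : Matrix (Fin m) (Fin m) ℂ)) := by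
    intro p
    have e1 : coeffMat (Matrix.linSubstEntries γ B) p =
        coeffMat ((g : Matrix (Fin m) (Fin m) ℂ).map C * B *
          ((h⁻¹ : GL (Fin m) ℂ) : Matrix (Fin m) (Fin m) ℂ).map C) p := by rw [hgh]
    rw [coeffMat_linSubstEntries _ _ haff, hγcoe, sum_diagonal_smul, coeffMat_C_mul_mul_C] at e1
    rw [mul_eq_of_eq_mul_mul_inv e1, Matrix.smul_mul]
  -- (4) regularity: the kernel of `Λ₀` is a line, on which `h` has an eigenvalue `γ₀ ≠ 0`
  set Λm : Matrix (Fin m) (Fin m) ℂ := constPart B with hΛm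
  have hK : Module.finrank ℂ (LinearMap.ker (Matrix.toLin' Λm)) = 1 := by
    have h1 := LinearMap.finrank_range_add_finrank_ker (Matrix.toLin' Λm)
    rw [Module.finrank_fin_fun] at h1
    have h2 : Module.finrank ℂ (LinearMap.range (Matrix.toLin' Λm)) = m - 1 := by
      rw [Matrix.toLin'_apply']; exact hreg.2
    have hm : 1 ≤ m := by
      rcases Nat.eq_zero_or_pos m with h0 | h0
      · subst h0
        exfalso
        have h3 : B.det = 1 := Matrix.det_isEmpty
        have h4 := congrArg constantCoeff hdet
        rw [h3, constantCoeff_perPoly ℂ (by omega : 1 ≤ n), map_one] at h4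
        exact one_ne_zero h4
      · exact h0
    omega
  let L : Lift (Matrix.toLin' Λm) (fun _ _ : Fin n => Matrix.toLin' (0 : Matrix (Fin m) (Fin m) ℂ)) 1
      (fun _ => (1 : ℂ)) :=
    liftOfMatrices Λm (fun _ _ => 0) 1 _ (fun _ => one_ne_zero) g h hΛ0 (fun _ _ => by simp)
  obtain ⟨γ₀, hγ₀, hker⟩ := exists_eigenvalue_of_finrank_ker_eq_one _ L.C L.map_ker_eq hK
  have hker' : LinearMap.ker (Matrix.toLin' (constPart B)) ≤
      Module.End.maxGenEigenspace (Matrix.toLin' (h : Matrix (Fin m) (Fin m) ℂ)) γ₀ := hker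
  -- (5) stub 2: every permutation is served at every level by a weight of `g` (acyclic weights by (ii))
  have hserved := hPW n m B (fun p : Fin n × Fin n => (d p.1 : ℂ) * (e p.2 : ℂ)) g h γ₀ hc0 hnocyc hreg
    hΛ0 hAv hker'
  -- (6) stub 3 at the middle level `⌊n/2⌋`, with the exact separation (iii): the CLASS count
  show n.choose (n / 2) ≤ m * confusion n r Λ (n / 2)
  refine hLC n m r Λ d e γ₀ (g : Matrix (Fin m) (Fin m) ℂ) hγ₀ hsep fun σ => ?_
  obtain ⟨I, hI, hne⟩ := hserved σ (n / 2) (by omega) (Nat.div_le_self n 2)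
  exact ⟨I, hI, hne⟩

/-- **THE SKELETON: the rung BY NAME, modulo exactly the three registered stubs.** [cite: LandsbergRessayre2017, §6] -/
theorem ConfusionCovering_proof :
    Summit.ValiantsHypothesis.ValiantsHypothesis.Cruxes.OrbitDimensionBound.Confusion.ConfusionCovering :=
  ConfusionCovering_of stub_genericElement stub_pathWeights stub_classCount

/-- For the record: the rung gives back the floor's conclusion shape once `κ ≤ 2^r` is supplied (Odlyzko's lemma,
a tree named fact; here as a hypothesis). [cite: Odlyzko1988, p. 127] -/
theorem floor_of_rung (hκ : ∀ (n r : ℕ) (Λ : Fin r → (Fin n ⊕ Fin n) → ℤ), confusion n r Λ (n / 2) ≤ 2 ^ r)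
    (h : Summit.ValiantsHypothesis.ValiantsHypothesis.Cruxes.OrbitDimensionBound.Confusion.ConfusionCovering) :
    Summit.ValiantsHypothesis.ValiantsHypothesis.Theses.FreeSubtorus.SubtorusCovering :=
  coveringRung_powLoss_iff.1 (CoveringRung.mono (ℓ := confusionLoss) (ℓ' := powLoss) (fun n r Λ => hκ n r Λ) h)

end

end Summit.ValiantsHypothesis.ValiantsHypothesis.Cruxes.OrbitDimensionBound.Confusion.Line
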